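import Summits.ResolutionOfSingularities.ResolutionOfSingularities.Theorems.PurelyInseparableDim4ChartClosureGraph
import Summits.ResolutionOfSingularities.ResolutionOfSingularities.Theorems.PurelyInseparableDim4ChartCentreClosed
import Literature.AlgebraicGeometry.Resolution.PointBlowupIntersectionMultiplicityFinite
import Literature.AlgebraicGeometry.Resolution.RegularBlowup
import Literature.AlgebraicGeometry.Resolution.BlowupsIntegral
import Literature.AlgebraicGeometry.Resolution.MarkedIdealsEtale
import Literature.AlgebraicGeometry.Resolution.HypersurfaceCentres
import Literature.AlgebraicGeometry.Resolution.HypersurfaceRestriction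
import HarnessLib

/-!
# Purely inseparable four-folds `z^p + F(x₁, …, x₄)`: the CLOSURE of an ESCAPING chart centre is the strict
# transform of the graph `Y`, a REGULAR INTEGRAL closed subscheme of `W₁` — Q1 of the S3-glob question at
# depth 2 for a next centre NOT inside the new exceptional divisor (brick S3-glob, part B2; cell `res-dim4-pi`, typ-2 g4)

[OURS · counted 0] (D-0157 DOOR 2; DR-157-C; desk WORD #97 (c); frame `PIDim4.TerminationImpliesOrderReduction`,
S3 (c)). Setting of `…ChartCentreClosed` §4 / `…ChartCentreEscape`: `π : W → 𝔸⁵_K` ANY blowing up along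
`V(z, x_S)`, `j ∈ S`, `Θ` a re-centring automorphism (`Θ z = z + h(x)`, `Θ xᵢ = xᵢ + bᵢ`, `b_j = 0`),
`φ = Spec Θ ≫ chartImm_j` the re-centred chart, `S'` the next coordinate centre and
`Zc = 𝓘(closure φ(V(z, x_{S'})))` its GLOBAL CENTRE (`comap_globalCentre`: `φ^* Zc = 𝓘Λ_{S'}` always; for
`S ∖ {j} ⊄ S'` the image is NOT closed, `not_isClosed_image_CΛ_chart`). NEW inputs (A2): the ring reading
`Θ(ψ(z^p + F)) = x_j^p (z^p + F₁)` of the chart dictionary and `p ≤ ord_{(x_{S'})} F₁`. PROVED here for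
`j ∉ S'` (the next centre is not contained in the exceptional divisor `x_j = 0` of the chart):

* `comap_chartImm_strictTransformIdeal_idealSheafOf` — on the `x_j`-chart the strict transform of ANY `V(J)`,
  `J ⊆ K[z, x]`, reads `idealSheafOf (J^st)` (`J^st` the tree's `coordStrictTransformIdeal`: flat base change
  of strict transforms + the ND affine dictionary `strictTransformIdeal_specMap_coordBlowupSubst`);
* `comap_chart_strictTransformIdeal_graph` — for the graph `Y = V(J_Y)` of A2/B1:
  **`φ^* St_π(𝒥_Y) = 𝓘Λ_{S'}`**;
* `isRegular_subscheme_strictTransformIdeal_graph`, `isIntegral_subscheme_strictTransformIdeal_graph` —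
  `V(St_π(𝒥_Y)) = Bl_{Y ∩ C} Y` (Stacks 080E, tree `isBlowup_lift_subschemeι_strictTransformIdeal`) is REGULAR
  (Liu 8.1.19 (a), tree `IsBlowup.isRegular_of_isRegular_subscheme`; inputs B1) and INTEGRAL;
* `support_strictTransformIdeal_graph` — **`supp St_π(𝒥_Y) = closure φ(V(z, x_{S'}))`** (an irreducible
  closed set containing the chart image as a non-empty open part);
* `strictTransformIdeal_graph_eq_globalCentre` — hence **`St_π(𝒥_Y) = Zc`** (a regular closed subscheme is
  the vanishing ideal of its support), and
* **`isRegular_globalCentre_of_reading_of_not_mem`** — Q1 of the S3-glob question, case `j ∉ S'`: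
  `Zc.subscheme` is a REGULAR scheme; packaged on the walk's data as `isRegular_globalCentre_step_of_not_mem`.

Case `j ∈ S'` (closure inside the exceptional divisor: a projective-linear sub-bundle) and Q2/Q3 are the
sequels. Nothing here is a statement about resolution of singularities in dimension ≥ 4 / characteristic `p`
(NOT proved anywhere in this programme). bears_on: LADDER-RESOLUTION:D157-DOOR2 (res-dim4-pi). Supports
stmt-ResolutionOfSingularities-16155 (helper, S3-glob B2).
-/

-- every declaration of this summit lives under `Summit.ResolutionOfSingularities.ResolutionOfSingularities`
-- (summit = problem), which the duplicate-namespace linter flags; house convention (cf. the Target file).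
set_option linter.dupNamespace false

noncomputable section

open MvPolynomial Finset CategoryTheory AlgebraicGeometry Opposite TopologicalSpace
open AlgebraicGeometry.Scheme.IdealSheafData (ofIdealTop vanishingIdeal)

namespace Summit.ResolutionOfSingularities.ResolutionOfSingularities.Theorems.PIDim4

open Literature.AlgebraicGeometry.Resolution
open Literature.AlgebraicGeometry.Resolution.AffinePointBlowup (P A γ coord Wtop ξ)

namespace ChartDictionary

variable {K : Type} [Field K] {p : ℕ} {S S' : Finset (Fin 4)} {j : Fin 4} {b : Fin 4 → K}
  {Θ : A 4 K ≃ₐ[K] A 4 K} {h : MvPolynomial (Fin 4) K} {F F₁ : MvPolynomial (Fin 4) K}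
  {W : Scheme.{0}} {π : W ⟶ P 4 K}

/-! ## §1 The strict transform read on the chart -/

/-- **On the `x_j`-chart the strict transform of `V(J)` reads `idealSheafOf (J^st)`**, `J^st` the
`x_j`-saturation of the total transform of `J` (tree `coordStrictTransformIdeal`): strict transforms commute
with the flat base change `chartImm` (`chartImm ≫ π = Spec ψ`), and along `Spec ψ` the ND affine dictionary computes
them. -/
theorem comap_chartImm_strictTransformIdeal_idealSheafOf (hj : j ∈ S)
    (hπ : IsBlowup π (AffineCoordBlowup.𝓘Λ 4 K (insert 0 (Fin.succ '' (S : Set (Fin 4)))))) (J : Ideal (A 4 K)) :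
    (strictTransformIdeal π (AffineCoordBlowup.𝓘Λ 4 K (insert 0 (Fin.succ '' (S : Set (Fin 4)))))
        (Hironaka2005.idealSheafOf J)).comap (AffineCoordBlowup.chartImm hπ (succ_mem_centreVars hj)) =
      Hironaka2005.idealSheafOf (coordStrictTransformIdeal K (insert 0 (Fin.succ '' (S : Set (Fin 4)))) j.succ J) := by
  haveI : IsProper π := hπ.isProper
  haveI : IsLocallyNoetherian W := LocallyOfFiniteType.isLocallyNoetherian π
  have hsq : AffineCoordBlowup.chartImm hπ (succ_mem_centreVars hj) ≫ π =
      Spec.map (CommRingCat.ofHom (coordBlowupSubst K (insert 0 (Fin.succ '' (S : Set (Fin 4)))) j.succ :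
        A 4 K →+* A 4 K)) ≫ 𝟙 (P 4 K) := by
    rw [Category.comp_id, AffineCoordBlowup.chartImm_comp hπ (succ_mem_centreVars hj)]
    rfl
  rw [comap_strictTransformIdeal_of_flat (t := 𝟙 (P 4 K)) hsq, Scheme.IdealSheafData.comap_id, Scheme.IdealSheafData.comap_id,
    Cruxes.EquisingularLiftNat.Sections.ND.𝓘Λ_eq_idealSheafOf,
    Cruxes.EquisingularLiftNat.Sections.ND.strictTransformIdeal_specMap_coordBlowupSubst K _ j.succ (succ_mem_centreVars hj)]

/-- **`φ^* St_π(𝒥_Y) = 𝓘Λ_{S'}`**: on the re-centred chart the strict transform of the graph `Y` is the next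
centre (A2's `map_clean_coordStrictTransformIdeal_graph`, transported through `idealSheafOf`). -/
theorem comap_chart_strictTransformIdeal_graph (hj : j ∈ S) (hjS' : j ∉ S') (hbj : b j = 0)
    (h0 : Θ (X 0) = X 0 + rename Fin.succ h) (hs : ∀ i : Fin 4, Θ (X i.succ) = X i.succ + C (b i))
    (hπ : IsBlowup π (AffineCoordBlowup.𝓘Λ 4 K (insert 0 (Fin.succ '' (S : Set (Fin 4))))))
    {H : MvPolynomial (Fin 4) K} (hH : coordBlowupSubst K (S : Set (Fin 4)) j H =
      X j * aeval (fun k => if k ∈ S' then (0 : MvPolynomial (Fin 4) K) else X k - C (b k)) h) :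
    (strictTransformIdeal π (AffineCoordBlowup.𝓘Λ 4 K (insert 0 (Fin.succ '' (S : Set (Fin 4)))))
        (Hironaka2005.idealSheafOf (Ideal.span (insert (X 0 - rename Fin.succ H)
          (((fun k : Fin 4 => (X k.succ - C (b k) : A 4 K)) '' ((S' \ S : Finset (Fin 4)) : Set (Fin 4))) ∪
           ((fun i : Fin 4 => (X i.succ - C (b i) * X j.succ : A 4 K)) '' ((S' ∩ S : Finset (Fin 4)) : Set (Fin 4)))))))).comap
      (Spec.map (CommRingCat.ofHom (Θ : A 4 K →+* A 4 K)) ≫ AffineCoordBlowup.chartImm hπ (succ_mem_centreVars hj)) =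
      AffineCoordBlowup.𝓘Λ 4 K (insert 0 (Fin.succ '' (S' : Set (Fin 4)))) := by
  rw [Scheme.IdealSheafData.comap_comp, comap_chartImm_strictTransformIdeal_idealSheafOf hj hπ,
    Hironaka2005.comap_specMap_idealSheafOf, map_clean_coordStrictTransformIdeal_graph hjS' hbj h0 hs hH,
    ← Cruxes.EquisingularLiftNat.Sections.ND.𝓘Λ_eq_idealSheafOf]

/-! ## §2 The strict transform of the graph is regular and integral -/

/-- **`V(St_π(𝒥_Y))` is REGULAR**: it is the blow-up of the regular `Y` along the regular `Y ∩ V(z, x_S)`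
(Stacks 080E + Liu 8.1.19 (a), through the tree). -/
theorem isRegular_subscheme_strictTransformIdeal_graph (hj : j ∈ S) (hjS' : j ∉ S')
    (hπ : IsBlowup π (AffineCoordBlowup.𝓘Λ 4 K (insert 0 (Fin.succ '' (S : Set (Fin 4))))))
    {H : MvPolynomial (Fin 4) K} (hHS : H ∈ Ideal.span (X '' (S : Set (Fin 4)) : Set (MvPolynomial (Fin 4) K))) :
    Scheme.IsRegular (strictTransformIdeal π (AffineCoordBlowup.𝓘Λ 4 K (insert 0 (Fin.succ '' (S : Set (Fin 4)))))
        (Hironaka2005.idealSheafOf (Ideal.span (insert (X 0 - rename Fin.succ H)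
          (((fun k : Fin 4 => (X k.succ - C (b k) : A 4 K)) '' ((S' \ S : Finset (Fin 4)) : Set (Fin 4))) ∪
           ((fun i : Fin 4 => (X i.succ - C (b i) * X j.succ : A 4 K)) '' ((S' ∩ S : Finset (Fin 4)) : Set (Fin 4)))))))).subscheme := by
  set C₀ := AffineCoordBlowup.𝓘Λ 4 K (insert 0 (Fin.succ '' (S : Set (Fin 4)))) with hC₀
  set 𝒥 := Hironaka2005.idealSheafOf (Ideal.span (insert (X 0 - rename Fin.succ H)
          (((fun k : Fin 4 => (X k.succ - C (b k) : A 4 K)) '' ((S' \ S : Finset (Fin 4)) : Set (Fin 4))) ∪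
           ((fun i : Fin 4 => (X i.succ - C (b i) * X j.succ : A 4 K)) '' ((S' ∩ S : Finset (Fin 4)) : Set (Fin 4))))))
    with h𝒥
  haveI : IsLocallyNoetherian 𝒥.subscheme := LocallyOfFiniteType.isLocallyNoetherian 𝒥.subschemeι
  have hbl := isBlowup_lift_subschemeι_strictTransformIdeal hπ 𝒥.subschemeι
  have hregY : Scheme.IsRegular 𝒥.subscheme := isRegular_subscheme_graph (S := S) hjS' b H
  have hregC : Scheme.IsRegular (C₀.comap 𝒥.subschemeι).subscheme := by
    -- `C₀ · 𝒪_Y = (𝒥 + C₀) · 𝒪_Y`, and `V((𝒥 + C₀)|_Y) ≅ V(𝒥 + C₀)` (tree `isRegular_subscheme_comap_subschemeι_iff`)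
    have heq : (𝒥 ⊔ C₀).comap 𝒥.subschemeι = C₀.comap 𝒥.subschemeι := by
      rw [(Scheme.IdealSheafData.map_gc 𝒥.subschemeι).l_sup, comap_subschemeι_self, bot_sup_eq]
    rw [← heq, isRegular_subscheme_comap_subschemeι_iff 𝒥 le_sup_left]
    exact isRegular_subscheme_graph_sup (S' := S') hj b hHS
  have hreg := hbl.isRegular_of_isRegular_subscheme hregY hregC
  rwa [Scheme.IdealSheafData.ker_subschemeι] at hreg

/-- **`V(St_π(𝒥_Y))` is INTEGRAL** (a blow-up of the integral `Y` along a non-zero ideal sheaf, `Y ⊄ V(z, x_S)`). -/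
theorem isIntegral_subscheme_strictTransformIdeal_graph (hj : j ∈ S) (hjS' : j ∉ S')
    (hπ : IsBlowup π (AffineCoordBlowup.𝓘Λ 4 K (insert 0 (Fin.succ '' (S : Set (Fin 4)))))) (b : Fin 4 → K)
    (H : MvPolynomial (Fin 4) K) :
    IsIntegral (strictTransformIdeal π (AffineCoordBlowup.𝓘Λ 4 K (insert 0 (Fin.succ '' (S : Set (Fin 4)))))
        (Hironaka2005.idealSheafOf (Ideal.span (insert (X 0 - rename Fin.succ H)
          (((fun k : Fin 4 => (X k.succ - C (b k) : A 4 K)) '' ((S' \ S : Finset (Fin 4)) : Set (Fin 4))) ∪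
           ((fun i : Fin 4 => (X i.succ - C (b i) * X j.succ : A 4 K)) '' ((S' ∩ S : Finset (Fin 4)) : Set (Fin 4)))))))).subscheme := by
  set C₀ := AffineCoordBlowup.𝓘Λ 4 K (insert 0 (Fin.succ '' (S : Set (Fin 4)))) with hC₀
  set 𝒥 := Hironaka2005.idealSheafOf (Ideal.span (insert (X 0 - rename Fin.succ H)
          (((fun k : Fin 4 => (X k.succ - C (b k) : A 4 K)) '' ((S' \ S : Finset (Fin 4)) : Set (Fin 4))) ∪
           ((fun i : Fin 4 => (X i.succ - C (b i) * X j.succ : A 4 K)) '' ((S' ∩ S : Finset (Fin 4)) : Set (Fin 4))))))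
    with h𝒥
  have hbl := isBlowup_lift_subschemeι_strictTransformIdeal hπ 𝒥.subschemeι
  haveI : IsIntegral 𝒥.subscheme := isIntegral_subscheme_graph (S := S) hjS' b H
  have hint := hbl.isIntegral (comap_subschemeι_graph_ne_bot hj hjS' b H)
  rwa [Scheme.IdealSheafData.ker_subschemeι] at hint

/-! ## §3 The support of the strict transform is the closure of the chart image -/

/-- **`supp St_π(𝒥_Y) = closure φ(V(z, x_{S'}))`.** The support is closed, irreducible (`V(St)` is integral),
contains `φ(V(z, x_{S'}))` and meets the chart exactly in it (`φ^* St = 𝓘Λ_{S'}`); a non-empty open part of an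
irreducible closed set is dense in it. -/
theorem support_strictTransformIdeal_graph (hj : j ∈ S) (hjS' : j ∉ S') (hbj : b j = 0)
    (h0 : Θ (X 0) = X 0 + rename Fin.succ h) (hs : ∀ i : Fin 4, Θ (X i.succ) = X i.succ + C (b i))
    (hπ : IsBlowup π (AffineCoordBlowup.𝓘Λ 4 K (insert 0 (Fin.succ '' (S : Set (Fin 4))))))
    {H : MvPolynomial (Fin 4) K} (hH : coordBlowupSubst K (S : Set (Fin 4)) j H =
      X j * aeval (fun k => if k ∈ S' then (0 : MvPolynomial (Fin 4) K) else X k - C (b k)) h) :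
    haveI : IsIso (CommRingCat.ofHom (Θ : A 4 K →+* A 4 K)) :=
      (inferInstance : IsIso Θ.toRingEquiv.toCommRingCatIso.hom)
    (strictTransformIdeal π (AffineCoordBlowup.𝓘Λ 4 K (insert 0 (Fin.succ '' (S : Set (Fin 4)))))
        (Hironaka2005.idealSheafOf (Ideal.span (insert (X 0 - rename Fin.succ H)
          (((fun k : Fin 4 => (X k.succ - C (b k) : A 4 K)) '' ((S' \ S : Finset (Fin 4)) : Set (Fin 4))) ∪
           ((fun i : Fin 4 => (X i.succ - C (b i) * X j.succ : A 4 K)) '' ((S' ∩ S : Finset (Fin 4)) : Set (Fin 4)))))))).support =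
      closureImage (Spec.map (CommRingCat.ofHom (Θ : A 4 K →+* A 4 K)) ≫ AffineCoordBlowup.chartImm hπ (succ_mem_centreVars hj))
        ((AffineCoordBlowup.𝓘Λ 4 K (insert 0 (Fin.succ '' (S' : Set (Fin 4))))).support : Set (P 4 K)) := by
  haveI : IsIso (CommRingCat.ofHom (Θ : A 4 K →+* A 4 K)) :=
    (inferInstance : IsIso Θ.toRingEquiv.toCommRingCatIso.hom)
  set φ := Spec.map (CommRingCat.ofHom (Θ : A 4 K →+* A 4 K)) ≫ AffineCoordBlowup.chartImm hπ (succ_mem_centreVars hj)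
    with hφ
  set St := strictTransformIdeal π (AffineCoordBlowup.𝓘Λ 4 K (insert 0 (Fin.succ '' (S : Set (Fin 4)))))
        (Hironaka2005.idealSheafOf (Ideal.span (insert (X 0 - rename Fin.succ H)
          (((fun k : Fin 4 => (X k.succ - C (b k) : A 4 K)) '' ((S' \ S : Finset (Fin 4)) : Set (Fin 4))) ∪
           ((fun i : Fin 4 => (X i.succ - C (b i) * X j.succ : A 4 K)) '' ((S' ∩ S : Finset (Fin 4)) : Set (Fin 4)))))))
    with hSt
  have hcomap : St.comap φ = AffineCoordBlowup.𝓘Λ 4 K (insert 0 (Fin.succ '' (S' : Set (Fin 4)))) :=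
    comap_chart_strictTransformIdeal_graph hj hjS' hbj h0 hs hπ hH
  -- the chart image lies in the support, and the support meets the chart in the chart image
  have hsub1 : φ '' (AffineCoordBlowup.CΛ 4 K (insert 0 (Fin.succ '' (S' : Set (Fin 4)))) : Set (P 4 K)) ⊆
      (St.support : Set W) := by
    rintro _ ⟨y, hy, rfl⟩
    have h2 : y ∈ (St.comap φ).support := by rw [hcomap, AffineCoordBlowup.support_𝓘Λ]; exact hy
    rw [Scheme.IdealSheafData.support_comap] at h2
    exact h2
  have hsub2 : (St.support : Set W) ∩ Set.range φ ⊆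
      φ '' (AffineCoordBlowup.CΛ 4 K (insert 0 (Fin.succ '' (S' : Set (Fin 4)))) : Set (P 4 K)) := by
    rintro _ ⟨hw, y, rfl⟩
    refine ⟨y, ?_, rfl⟩
    have h2 : y ∈ (St.comap φ).support := by rw [Scheme.IdealSheafData.support_comap]; exact hw
    rw [hcomap, AffineCoordBlowup.support_𝓘Λ] at h2
    exact h2
  -- the support is irreducible
  haveI := isIntegral_subscheme_strictTransformIdeal_graph (S' := S') hj hjS' hπ b H
  have hirr : IsIrreducible (St.support : Set W) := by
    have h1 := (IrreducibleSpace.isIrreducible_univ St.subscheme).image St.subschemeι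
      St.subschemeι.continuous.continuousOn
    rwa [Set.image_univ, Scheme.IdealSheafData.range_subschemeι] at h1
  have hne : ((St.support : Set W) ∩ Set.range φ).Nonempty :=
    ⟨φ (ξ 4 K), hsub1 ⟨ξ 4 K, AffineCoordBlowup.ξ_mem_CΛ 4 K _, rfl⟩, ξ 4 K, rfl⟩
  have hcl : (St.support : Set W) ⊆
      closure (φ '' (AffineCoordBlowup.CΛ 4 K (insert 0 (Fin.succ '' (S' : Set (Fin 4)))) : Set (P 4 K))) :=
    (subset_closure_inter_of_isPreirreducible_of_isOpen hirr.2 φ.isOpenEmbedding.isOpen_range hne).trans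
      (closure_mono hsub2)
  apply Closeds.ext
  rw [coe_closureImage, AffineCoordBlowup.support_𝓘Λ]
  exact le_antisymm hcl (St.support.isClosed.closure_subset_iff.mpr hsub1)

/-- **`St_π(𝒥_Y) = Zc`**: the strict transform of the graph IS the global centre of the next coordinate centre
(a regular closed subscheme is the vanishing ideal of its support). -/
theorem strictTransformIdeal_graph_eq_globalCentre (hj : j ∈ S) (hjS' : j ∉ S') (hbj : b j = 0)
    (h0 : Θ (X 0) = X 0 + rename Fin.succ h) (hs : ∀ i : Fin 4, Θ (X i.succ) = X i.succ + C (b i))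
    (hπ : IsBlowup π (AffineCoordBlowup.𝓘Λ 4 K (insert 0 (Fin.succ '' (S : Set (Fin 4))))))
    {H : MvPolynomial (Fin 4) K} (hH : coordBlowupSubst K (S : Set (Fin 4)) j H =
      X j * aeval (fun k => if k ∈ S' then (0 : MvPolynomial (Fin 4) K) else X k - C (b k)) h) :
    haveI : IsIso (CommRingCat.ofHom (Θ : A 4 K →+* A 4 K)) :=
      (inferInstance : IsIso Θ.toRingEquiv.toCommRingCatIso.hom)
    strictTransformIdeal π (AffineCoordBlowup.𝓘Λ 4 K (insert 0 (Fin.succ '' (S : Set (Fin 4)))))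
        (Hironaka2005.idealSheafOf (Ideal.span (insert (X 0 - rename Fin.succ H)
          (((fun k : Fin 4 => (X k.succ - C (b k) : A 4 K)) '' ((S' \ S : Finset (Fin 4)) : Set (Fin 4))) ∪
           ((fun i : Fin 4 => (X i.succ - C (b i) * X j.succ : A 4 K)) '' ((S' ∩ S : Finset (Fin 4)) : Set (Fin 4))))))) =
      vanishingIdeal (closureImage
        (Spec.map (CommRingCat.ofHom (Θ : A 4 K →+* A 4 K)) ≫ AffineCoordBlowup.chartImm hπ (succ_mem_centreVars hj))
        ((AffineCoordBlowup.𝓘Λ 4 K (insert 0 (Fin.succ '' (S' : Set (Fin 4))))).support : Set (P 4 K))) := by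
  rw [← support_strictTransformIdeal_graph hj hjS' hbj h0 hs hπ hH]
  exact eq_vanishingIdeal_support_of_isRegular _
    (isRegular_subscheme_strictTransformIdeal_graph (S' := S') hj hjS' hπ (mem_span_X_of_lift hj hH))

/-! ## §4 Q1 of the S3-glob question for `j ∉ S'` -/

/-- **Q1 (`j ∉ S'`): THE GLOBAL CENTRE OF AN ARBITRARY — POSSIBLY ESCAPING — NEXT COORDINATE CENTRE IS A REGULAR
SCHEME.** Let `π : W → 𝔸⁵_K` be any blowing up along `V(z, x_S)`, `j ∈ S`, `Θ` a re-centring (`Θ z = z + h`,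
`Θ xᵢ = xᵢ + bᵢ`, `b_j = 0`) READING the transform (`Θ(ψ(z^p + F)) = x_j^p (z^p + F₁)`, `p ≤ ord_{(x_S)} F`) and
`S' ∌ j` permissible for `F₁` (`p ≤ ord_{(x_{S'})} F₁`). Then the reduced closed subscheme of `W` on the closure
of `φ(V(z, x_{S'}))` is regular: it is the strict transform `Bl_{Y ∩ C} Y` of the regular graph `Y`. No
hypothesis `S ∖ {j} ⊆ S'`. -/
theorem isRegular_globalCentre_of_reading_of_not_mem [Fact p.Prime] [CharP K p] (hj : j ∈ S) (hjS' : j ∉ S')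
    (hbj : b j = 0) (h0 : Θ (X 0) = X 0 + rename Fin.succ h) (hs : ∀ i : Fin 4, Θ (X i.succ) = X i.succ + C (b i))
    (hπ : IsBlowup π (AffineCoordBlowup.𝓘Λ 4 K (insert 0 (Fin.succ '' (S : Set (Fin 4))))))
    (hperm : (p : ℕ∞) ≤ CentreBlowup.ordAlong S F)
    (hread : Θ (coordBlowupSubst K (insert 0 (Fin.succ '' (S : Set (Fin 4)))) j.succ (hyp p F)) =
      X j.succ ^ p * hyp p F₁)
    (hperm' : (p : ℕ∞) ≤ CentreBlowup.ordAlong S' F₁) :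
    haveI : IsIso (CommRingCat.ofHom (Θ : A 4 K →+* A 4 K)) :=
      (inferInstance : IsIso Θ.toRingEquiv.toCommRingCatIso.hom)
    Scheme.IsRegular (vanishingIdeal (closureImage
      (Spec.map (CommRingCat.ofHom (Θ : A 4 K →+* A 4 K)) ≫ AffineCoordBlowup.chartImm hπ (succ_mem_centreVars hj))
      ((AffineCoordBlowup.𝓘Λ 4 K (insert 0 (Fin.succ '' (S' : Set (Fin 4))))).support : Set (P 4 K)))).subscheme := by
  obtain ⟨H, hH⟩ := exists_lift_twist hj hbj h0 hs hperm hread hperm'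
  rw [← strictTransformIdeal_graph_eq_globalCentre hj hjS' hbj h0 hs hπ hH]
  exact isRegular_subscheme_strictTransformIdeal_graph (S' := S') hj hjS' hπ (mem_span_X_of_lift hj hH)

/-- **Q1 on the walk's own data (`j ∉ S'`).** For a presented state `s`, a permissible `S ∋ j`, a point `b`
(`b_j = 0`) and a next centre `S' ∌ j` permissible for the stepped state `step p S j b s`: with the re-centring
`Θ` of the dictionary (reading the transform on the chart), the global centre of `V(z, x_{S'})` is regular. -/
theorem isRegular_globalCentre_step_of_not_mem [Fact p.Prime] [CharP K p] [PerfectRing K p] [DecidableEq K]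
    (hj : j ∈ S) (hjS' : j ∉ S') (hbj : b j = 0) (s : State K) (hperm : (p : ℕ∞) ≤ CentreBlowup.ordAlong S s.F)
    (hπ : IsBlowup π (AffineCoordBlowup.𝓘Λ 4 K (insert 0 (Fin.succ '' (S : Set (Fin 4))))))
    (hperm' : (p : ℕ∞) ≤ CentreBlowup.ordAlong S' (CentreBlowup.step p S j b s).F) :
    ∃ (Θ : A 4 K ≃ₐ[K] A 4 K) (h : MvPolynomial (Fin 4) K) (_ : IsIso (CommRingCat.ofHom (Θ : A 4 K →+* A 4 K))),
      Θ (X 0) = X 0 + rename Fin.succ h ∧ (∀ i : Fin 4, Θ (X i.succ) = X i.succ + C (b i)) ∧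
      Θ (coordBlowupSubst K (insert 0 (Fin.succ '' (S : Set (Fin 4)))) j.succ (hyp p s.F)) =
        X j.succ ^ p * hyp p (CentreBlowup.step p S j b s).F ∧
      Scheme.IsRegular (vanishingIdeal (closureImage
        (Spec.map (CommRingCat.ofHom (Θ : A 4 K →+* A 4 K)) ≫ AffineCoordBlowup.chartImm hπ (succ_mem_centreVars hj))
        ((AffineCoordBlowup.𝓘Λ 4 K (insert 0 (Fin.succ '' (S' : Set (Fin 4))))).support : Set (P 4 K)))).subscheme := by
  obtain ⟨θ, h, h0, hs, h1, -⟩ := exists_clean_translate_hyp_eq_step p hj hbj s hperm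
  -- the re-centring of record: translation by `b`, then cleaning by `h`
  let Θ : A 4 K ≃ₐ[K] A 4 K := (AffinePointBlowup.translateEquiv (Fin.cases 0 b)).trans θ
  have hΘ0 : Θ (X 0) = X 0 + rename Fin.succ h := by
    change θ (AffinePointBlowup.translateEquiv (Fin.cases 0 b) (X 0)) = _
    rw [AffinePointBlowup.translateEquiv_X, Fin.cases_zero, C_0, add_zero, h0]
  have hΘs : ∀ i : Fin 4, Θ (X i.succ) = X i.succ + C (b i) := fun i => by
    change θ (AffinePointBlowup.translateEquiv (Fin.cases 0 b) (X i.succ)) = _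
    rw [AffinePointBlowup.translateEquiv_X, Fin.cases_succ, map_add, hs]
    exact congrArg _ (θ.commutes (b i))
  have hread : Θ (coordBlowupSubst K (insert 0 (Fin.succ '' (S : Set (Fin 4)))) j.succ (hyp p s.F)) =
      X j.succ ^ p * hyp p (CentreBlowup.step p S j b s).F := by
    change θ (AffinePointBlowup.translateEquiv (Fin.cases 0 b) _) = _
    rw [← h1]
    rfl
  haveI hiso : IsIso (CommRingCat.ofHom (Θ : A 4 K →+* A 4 K)) :=
    (inferInstance : IsIso Θ.toRingEquiv.toCommRingCatIso.hom)
  exact ⟨Θ, h, hiso, hΘ0, hΘs, hread,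
    isRegular_globalCentre_of_reading_of_not_mem hj hjS' hbj hΘ0 hΘs hπ hperm hread hperm'⟩

end ChartDictionary

end Summit.ResolutionOfSingularities.ResolutionOfSingularities.Theorems.PIDim4

end
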